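import Literature.NumberTheory.LFunctions.ConreyIwaniec2002GenusCharByValues
import Literature.NumberTheory.QuadraticFields.GenusCharactersExhaust
import HarnessLib

/-!
# Conrey–Iwaniec (2002), §2 (2.19) / §4 (4.21): genus characters by values — tools for the genus classification of `p(c)`

B. Conrey, H. Iwaniec, *Spacing of zeros of Hecke `L`-functions and the class number problem*,
Acta Arith. 103 (2002), §2 (2.19) [held text `paper:arxiv-math_0111012`, p0006:L50–60]: "Any real
character `ψ ∈ Ĉl(K)` is given uniquely by `ψ(𝔭) = χ_v(N𝔭)` if `p ∤ v`, `χ_w(N𝔭)` if `p ∤ w`,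
where `χ_vχ_w = χ_q` … different factorizations `vw = q` up to the order yield distinct real class
group characters." Helpers `--supports` the registered sub-stub S3e1 `stub_genus_classification` of
SKELETON S3 (cell `landau-siegel/ls-inputs`, line `theta-circle-method`), all PROVED:

* `voronoiMainCoeff_eq_zero_of_mul_self_ne_one` — `voronoiMainCoeff q ℓ ψ ≡ 0` for non-real `ψ`
  (the tree's `mul_self_eq_one_of_isGenusCharFor`, `ConreyIwaniec2002GenusCharByValues.lean`);
* `genusCharProd_eq_prod_dite`, `genusCharProd_union` — the tree's `genusCharProd hK S` as an
  honest product over `S`, multiplicative over disjoint unions;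
* `isGenusCharFor_unique` — **"given uniquely"**: for an imaginary quadratic `K` with odd `d_K` and
  squarefree divisors `D₁, D₂ ∣ |d_K|` both of Dirichlet type for the same `ψ`, `D₂ = D₁` or
  `D₂ = |d_K|/D₁` (the symmetric difference of their prime sets is `∅` or all of the primes, else
  the tree's `exists_prime_jacobiSym_genusModulus_eq_neg_one` gives a prime `𝔮` with
  `ψ(𝔮)² = (N𝔮/D₁)(N𝔮/D₂) = −1`).

## References

* [ConreyIwaniec2002] B. Conrey, H. Iwaniec, Acta Arith. 103 (2002) 259–312, arXiv:math/0111012: §2 (2.19); §4 (4.21).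
* [Cox2013] D. A. Cox, *Primes of the form x² + ny²*, 2nd ed. (2013), §3.B Thm. 3.15.
-/

noncomputable section

open scoped NumberField NumberTheorySymbols nonZeroDivisors
open NumberField IsDedekindDomain Finset

namespace Literature.NumberTheory.LFunctions

namespace ConreyIwaniec2002

open Literature.NumberTheory.LFunctions.NumberField
open Literature.NumberTheory.QuadraticFields.Quadratic
open Literature.NumberTheory.EllipticCurves (IsImaginaryQuadratic)

variable {K : Type*} [Field K] [NumberField K]

/-! ### Dirichlet type forces reality -/

/-- The value of a product of class-group characters at a prime. [folklore] -/
private theorem primeValue_mul' (ψ₁ ψ₂ : ClassGroup (𝓞 K) →* ℂˣ) (v : HeightOneSpectrum (𝓞 K)) :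
    classGroupCharPrimeValue (ψ₁ * ψ₂) v = classGroupCharPrimeValue ψ₁ v * classGroupCharPrimeValue ψ₂ v := by
  simp only [classGroupCharPrimeValue_apply, MonoidHom.mul_apply, Units.val_mul]

/-- `(n/D)² = 1` for `(n, D) = 1`, as complex numbers. [folklore] -/
private theorem jacobiSym_sq_eq_one' {n D : ℕ} (h : n.Coprime D) : ((J((n : ℤ) | D) : ℂ)) ^ 2 = 1 := by
  have h1 : J((n : ℤ) | D) ^ 2 = 1 := jacobiSym.sq_one (by rwa [Int.gcd_natCast_natCast])
  exact_mod_cast congrArg (fun z : ℤ ↦ (z : ℂ)) h1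

/-- **`p ≡ 0` for non-real `ψ`** (`q ≠ 0`): `voronoiMainCoeff q ℓ ψ c = 0` for every `c` when
`ψ² ≠ 1` (Proposition 3.2: cusp forms have no leading term). [cite: ConreyIwaniec2002, §4 (4.21)] -/
theorem voronoiMainCoeff_eq_zero_of_mul_self_ne_one {q : ℕ} (hq : q ≠ 0) (ℓ : ℝ)
    {ψ : ClassGroup (𝓞 K) →* ℂˣ} (hψ : ψ * ψ ≠ 1) (c : ℕ) : voronoiMainCoeff q ℓ ψ c = 0 := by
  unfold voronoiMainCoeff
  refine Set.indicator_of_notMem (fun hc ↦ hψ ?_) _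
  exact mul_self_eq_one_of_isGenusCharFor (Nat.gcd_pos_of_pos_right c (Nat.pos_of_ne_zero hq)).ne' hc

/-! ### `genusCharProd` as a product over `S` -/

open scoped Classical in
/-- The genus character product `ψ_S = ∏_{p∈S}ψ_p` as a plain product over `S` (the membership
proofs discharged by a `dite`). [cite: Cox2013, §3.B Thm. 3.15] -/
theorem genusCharProd_eq_prod_dite (hK : IsImaginaryQuadratic K) (S : Finset ℕ)
    (hS : ∀ p ∈ S, p.Prime ∧ p ≠ 2 ∧ (p : ℤ) ∣ NumberField.discr K) :
    genusCharProd hK S hS =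
      ∏ p ∈ S, (if h : p.Prime ∧ p ≠ 2 ∧ (p : ℤ) ∣ NumberField.discr K then
        @genusChar K _ _ hK p ⟨h.1⟩ h.2.1 h.2.2 else 1) := by
  rw [genusCharProd]
  rw [← Finset.prod_attach S (f := fun p ↦ (if h : p.Prime ∧ p ≠ 2 ∧ (p : ℤ) ∣ NumberField.discr K then
        @genusChar K _ _ hK p ⟨h.1⟩ h.2.1 h.2.2 else 1))]
  refine Finset.prod_congr rfl fun p _ ↦ ?_
  rw [dif_pos (hS p.1 p.2)]

/-- **Multiplicativity over disjoint unions**: `ψ_{S ∪ T} = ψ_S · ψ_T` for disjoint `S, T`.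
[cite: Cox2013, §3.B Thm. 3.15] -/
theorem genusCharProd_union (hK : IsImaginaryQuadratic K) {S T : Finset ℕ} (hdisj : Disjoint S T)
    (hS : ∀ p ∈ S, p.Prime ∧ p ≠ 2 ∧ (p : ℤ) ∣ NumberField.discr K)
    (hT : ∀ p ∈ T, p.Prime ∧ p ≠ 2 ∧ (p : ℤ) ∣ NumberField.discr K)
    (hST : ∀ p ∈ S ∪ T, p.Prime ∧ p ≠ 2 ∧ (p : ℤ) ∣ NumberField.discr K) :
    genusCharProd hK (S ∪ T) hST = genusCharProd hK S hS * genusCharProd hK T hT := by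
  classical
  rw [genusCharProd_eq_prod_dite, genusCharProd_eq_prod_dite, genusCharProd_eq_prod_dite,
    Finset.prod_union hdisj]

/-! ### Uniqueness of the Dirichlet modulus up to the complementary divisor -/

/-- A squarefree number is the product of its prime factors. [folklore] -/
private theorem prod_primeFactors_eq {D : ℕ} (hD : Squarefree D) : ∏ p ∈ D.primeFactors, p = D :=
  Nat.prod_primeFactors_of_squarefree hD

/-- **"Given uniquely" (2.19)**: for an imaginary quadratic field with odd discriminant, if `ψ`
is of Dirichlet type `(·/D₁)` and `(·/D₂)` for squarefree `D₁, D₂ ∣ |d_K|`, then `D₂ = D₁` or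
`D₁·D₂ = |d_K|·(D₁,D₂)²` — i.e. `D₂ = |d_K|/D₁` when `(D₁, D₂) = 1`; precisely: the symmetric
difference `U` of the prime sets is empty or `D_U = |d_K|`. Else a prime `𝔮` of prime norm
`p > |d_K|` with `(p/D_U) = −1` (the tree's `exists_prime_jacobiSym_genusModulus_eq_neg_one`)
has `1 = ψ(𝔮)² = (p/D₁)(p/D₂) = (p/D_U)(p/D_{∩})² = −1`. [cite: ConreyIwaniec2002, §2 (2.19)] -/
theorem isGenusCharFor_unique (hK : IsImaginaryQuadratic K) (hodd : Odd (NumberField.discr K))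
    {ψ : ClassGroup (𝓞 K) →* ℂˣ} {D₁ D₂ : ℕ} (hsq₁ : Squarefree D₁) (hsq₂ : Squarefree D₂)
    (hdvd₁ : D₁ ∣ (NumberField.discr K).natAbs) (hdvd₂ : D₂ ∣ (NumberField.discr K).natAbs)
    (h₁ : IsGenusCharFor ψ D₁) (h₂ : IsGenusCharFor ψ D₂) :
    D₂ = D₁ ∨ genusModulus (symmDiff D₁.primeFactors D₂.primeFactors) = (NumberField.discr K).natAbs := by
  classical
  set S := D₁.primeFactors with hSdef
  set T := D₂.primeFactors with hTdef
  set U := symmDiff S T with hUdef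
  have hD0 : (NumberField.discr K).natAbs ≠ 0 := Int.natAbs_ne_zero.mpr (NumberField.discr_ne_zero K)
  have hprops : ∀ {D : ℕ}, D ∣ (NumberField.discr K).natAbs → ∀ p ∈ D.primeFactors,
      p.Prime ∧ p ≠ 2 ∧ (p : ℤ) ∣ NumberField.discr K := by
    intro D hD p hp
    obtain ⟨hpp, hpD, -⟩ := Nat.mem_primeFactors.mp hp
    have hpd : p ∣ (NumberField.discr K).natAbs := hpD.trans hD
    refine ⟨hpp, ?_, Int.natCast_dvd.mpr hpd⟩
    rintro rfl
    have h2 : (2 : ℤ) ∣ NumberField.discr K := Int.natCast_dvd.mpr hpd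
    obtain ⟨k, hk⟩ := hodd
    omega
  have hS : ∀ p ∈ S, p.Prime ∧ p ≠ 2 ∧ (p : ℤ) ∣ NumberField.discr K := hprops hdvd₁
  have hT : ∀ p ∈ T, p.Prime ∧ p ≠ 2 ∧ (p : ℤ) ∣ NumberField.discr K := hprops hdvd₂
  have hU : ∀ p ∈ U, p.Prime ∧ p ≠ 2 ∧ (p : ℤ) ∣ NumberField.discr K := forall_mem_symmDiff hS hT
  have hDS : genusModulus S = D₁ := prod_primeFactors_eq hsq₁
  have hDT : genusModulus T = D₂ := prod_primeFactors_eq hsq₂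
  by_cases hUe : U = ∅
  · left
    have hST : S = T := by
      have hUe' : symmDiff S T = (⊥ : Finset ℕ) := by rw [Finset.bot_eq_empty]; exact hUe
      exact symmDiff_eq_bot.mp hUe'
    rw [← hDS, ← hDT, hST]
  · right
    by_contra hne
    have hUne : U.Nonempty := Finset.nonempty_iff_ne_empty.mpr hUe
    have hdvdU : genusModulus U ∣ (NumberField.discr K).natAbs := genusModulus_dvd_natAbs_discr hU
    have hlt : genusModulus U < (NumberField.discr K).natAbs :=
      lt_of_le_of_ne (Nat.le_of_dvd (Nat.pos_of_ne_zero hD0) hdvdU) hne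
    obtain ⟨v, p, hp, hv, hpD, hJ⟩ := exists_prime_jacobiSym_genusModulus_eq_neg_one hK.1 hU hUne hlt
    -- `N v = p` is prime to `D₁`, `D₂`
    have hcopD : p.Coprime (NumberField.discr K).natAbs := by
      refine hp.coprime_iff_not_dvd.mpr fun h ↦ ?_
      exact absurd (Nat.le_of_dvd (Nat.pos_of_ne_zero hD0) h) (not_le.mpr hpD)
    have hcop₁ : (Ideal.absNorm v.asIdeal).Coprime D₁ := by rw [hv]; exact hcopD.coprime_dvd_right hdvd₁
    have hcop₂ : (Ideal.absNorm v.asIdeal).Coprime D₂ := by rw [hv]; exact hcopD.coprime_dvd_right hdvd₂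
    have e₁ := h₁ v hcop₁
    have e₂ := h₂ v hcop₂
    rw [hv] at e₁ e₂
    -- `ψ(v)² = (p/D₁)(p/D₂)` and `ψ(v)² = 1`
    have hsq : classGroupCharPrimeValue ψ v ^ 2 = 1 := by
      rw [e₁, jacobiSym_sq_eq_one' (hv ▸ hcop₁)]
    have hprod : (J((p : ℤ) | D₁) : ℂ) * (J((p : ℤ) | D₂) : ℂ) = 1 := by
      rw [← e₁, ← e₂, ← pow_two, hsq]
    -- `(p/D₁)(p/D₂) = (p/D_U)(p/D_∩)²`
    have hI0 : genusModulus (S ∩ T) ≠ 0 :=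
      genusModulus_ne_zero fun r hr ↦ (hS r (Finset.mem_inter.mp hr).1).1.ne_zero
    have hU0 : genusModulus U ≠ 0 := genusModulus_ne_zero fun r hr ↦ (hU r hr).1.ne_zero
    have hS0 : genusModulus S ≠ 0 := by rw [hDS]; exact hsq₁.ne_zero
    have hT0 : genusModulus T ≠ 0 := by rw [hDT]; exact hsq₂.ne_zero
    have hmul : J((p : ℤ) | D₁) * J((p : ℤ) | D₂) =
        J((p : ℤ) | genusModulus U) * J((p : ℤ) | genusModulus (S ∩ T)) ^ 2 := by
      rw [← hDS, ← hDT, ← jacobiSym.mul_right' _ hS0 hT0, genusModulus_mul_genusModulus, sq,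
        jacobiSym.mul_right' _ hU0 (mul_ne_zero hI0 hI0), jacobiSym.mul_right' _ hI0 hI0, sq]
    have hsqI : J((p : ℤ) | genusModulus (S ∩ T)) ^ 2 = 1 := by
      have hcop : ((p : ℤ)).gcd (genusModulus (S ∩ T)) = 1 := by
        rw [Int.gcd_natCast_natCast]
        exact coprime_genusModulus_of_lt (fun r hr ↦ hS r (Finset.mem_inter.mp hr).1) hp hpD
      exact jacobiSym.sq_one hcop
    rw [hsqI, mul_one, hJ] at hmul
    have : (J((p : ℤ) | D₁) : ℂ) * (J((p : ℤ) | D₂) : ℂ) = -1 := by exact_mod_cast hmul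
    rw [hprod] at this
    norm_num at this

end ConreyIwaniec2002

end Literature.NumberTheory.LFunctions

end
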